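import Summits.HodgeConjecture.CorCM.HypLiu418.A3Liu418GSThmD6OneCurve
import Literature.NumberTheory.Automorphic.Liu2021.Def411WeilCarriersIrreducibleOrZeroAtLine
import HarnessLib

/-!
# The registered d6 carrier `ω⋆ = ω(μ, ε, χ)|_{U(J⋆)}` of the unitary Shimura CURVE is IRREDUCIBLE OR ZERO — and NOT always irreducible

Cell `hodgecm-mathlib`, crux `HLiu418` (stmt-HodgeConjecture-24832), d6 line (`Cruxes/HLiu418/Lines/d6_cm_curve`, HOME card v3.10 §0⁸;
A-plan2 (g12) 02:38:54Z: S2′ registration shape `s2primeShape_of_sockets`, input (i) «`Representation.IsIrreducible ω⋆`»).  The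
REGISTERED carrier of the d6 texts (`thmD6OneCurveCUF`, `S2primeShape`) is

  `ω⋆ := (rhoVAtLine F⁺ F c 2 finProdFinEquiv (diag dJ) … (hsChiGS F finProdFinEquiv dJ hdJ hdJ0 χₕ hχu hχs) a χ).comp
          (finAdelicCongr F⁺ F c g⋆ ht hg).symm.toMonoidHom : Representation ℂ (U(J⋆)(𝔸_{F⁺,f})) (ω(μ, ε, χ) at the line ⟨a⟩)`

(registered instance `χₕ := toHeckeCharacter F (galConj c μ)`, `a := r.toFun ε`), of RANK `n = 2`.  Input (i) AS WORDED — Mathlib's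
`Representation.IsIrreducible`, which entails `Nontrivial` — is FALSE over the registered binders: by [Liu2021, App. D Lem. D.1 (1)]
the local factor of `ω(μ, ε, χ) = ⊗'_v ω(μ_v, ε_v, χ_v)` at a finite place where `(F_v², diag dJ)` is ANISOTROPIC vanishes for one
character of `E_v¹`, such places exist (parity of `∏_v η_v(−det) = 1` against the signature clause `_hsig`), and then `ω⋆ = 0`.
What print uses (Thm. D.6 (1) presupposes `π^∞ ≅ ω(μ, ε, χ)` irreducible) and what the S2′ sockets need (`omegaHom` out of a zero
carrier is `{0}`, so every conclusion about its values holds) is Liu's reading «IRREDUCIBLE OR ZERO» (`Def411AsPrinted.IsIrreducibleOrZero`).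
This file proves THAT at the registered carrier, from tree theorems only (★ `Def411WeilCarriers.isIrreducibleOrZero_rhoVAtLine_chiSplittingLine`:
MVW IV.4 at the non-split places, the `GL₂` model + [Zelevinsky1980] at the split places, ⊗' + [Flath1979] globally, the ZERO
propagation `FiniteAdelicWeilCentralCoinvariantsZero`, the twist-free comparison at the χ-attached splitting):

* `isIrreducibleOrZero_rhoVAtLine_chiGS_comp` — for ANY surjective `ι : G →* U(diag dJ)(𝔸_f)`;
* `isIrreducibleOrZero_omegaStarGS` — at the registered frame transport `ι := (finAdelicCongr F⁺ F c g⋆ ht hg).symm`;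
* `subsingleton_or_isIrreducible_omegaStarGS` — the same as the case split `ω⋆ = 0 ∨ IsIrreducible ω⋆` the S2′ assembler consumes.

Theorems only (3); no definition, no named fact, no instance, no `sorry`.  Count-neutral: HC_CM is proved only modulo the 7 printed
citations until rung 0 closes.

## References
* [Liu2021] Y. Liu, *Fourier–Jacobi cycles and arithmetic relative trace formula*, Camb. J. Math. 9 (2021) = arXiv:2102.11518: Def. 4.11
  (FJcycle.tex l. 2092–2096, «irreducible admissible representation» — an `n ≥ 3` sentence), App. D §D.1 Steps 2–3 (l. 5217–5221),
  Lem. D.1 first sentence + (1) (l. 5226–5229), §D.3 (l. 5355), Thm. D.6 (1) (l. 5436–5443).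
* [GelbartRogawski1991] S. Gelbart, J. Rogawski, Invent. Math. 105 (1991), §3.1 Prop. 3.1.1 p. 455 L1–3, Remark p. 457 L4–13.
* [MoeglinVignerasWaldspurger1987] C. Mœglin, M.-F. Vignéras, J.-L. Waldspurger, LNM 1291, Chap. 3 IV.4 Thm principal 1a), 2a).
* [Flath1979] D. Flath, PSPM 33 (1979) part 1, §2, Theorem 2 / Example 2.
-/

noncomputable section

open scoped Matrix NumberField
open NumberField NumberField.InfinitePlace
open Literature.NumberTheory.Automorphic Literature.NumberTheory.Automorphic.UnitaryGroup
open Literature.NumberTheory.Automorphic.Liu2021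
open Literature.NumberTheory.GaloisRepresentations Literature.RepresentationTheory.HarrisKudlaSweet1996
open Literature.NumberTheory.GelbartRogawski1991 Literature.NumberTheory.GelbartRogawski1991.UnitaryDualPair
open Literature.NumberTheory.Automorphic.Liu2021.Def411WeilCarriersDoubling
open Literature.NumberTheory.Automorphic.Liu2021.Def411WeilCarriers (TW JW JW_eq isSymm_TW isUnit_det_TW Chi rhoVAtLine omegaAtLine
  isIrreducibleOrZero_rhoVAtLine_chiSplittingLine_comp_of_surjective)

namespace Summit.HodgeConjecture.CorCM.Lines.A3Liu418

variable (F : CMField) (dJ : Fin 2 → F) (hdJ : ∀ i, IsCMField.complexConj F (dJ i) = dJ i) (hdJ0 : ∀ i, dJ i ≠ 0)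
  (χₕ : HeckeCharacter F) (hχu : χₕ.IsUnitary) (hχs : IsSplittingChar F 1 χₕ)
  (a : (↥(maximalRealSubfield F))ˣ) (χ : Chi ↥(maximalRealSubfield F) F (IsCMField.complexConj F))

/-- **`ω(μ, ε, χ)` at the line `⟨a⟩`, at the χ-splitting `sChiGS`, is IRREDUCIBLE OR ZERO through any SURJECTIVE
`ι : G →* U(diag dJ)(𝔸_{F⁺,f})`** ([Liu2021, Def. 4.11] «irreducible», read at rank 2 as Lem. D.1's «irreducible … (1) zero iff …») —
★ `Def411WeilCarriers.isIrreducibleOrZero_rhoVAtLine_chiSplittingLine_comp_of_surjective` at `N' := 2`, `e₁ := finProdFinEquiv` (`hsChiGS … a`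
IS `isCompatible_chiSplittingLine …` by definition). [cite: Liu2021, Def. 4.11 (FJcycle.tex l. 2092–2096), App. D Lemma D.1 (1) (l. 5226–5229)]
[cite: GelbartRogawski1991, §3.1 Prop. 3.1.1 p. 455 L1–3] -/
theorem isIrreducibleOrZero_rhoVAtLine_chiGS_comp {G : Type} [Group G]
    (ι : G →* UnitaryGroup.finAdelic ↥(maximalRealSubfield F) F (IsCMField.complexConj F) 2 (Matrix.diagonal dJ))
    (hι : Function.Surjective ι) :
    IsIrreducibleOrZero
      ((rhoVAtLine ↥(maximalRealSubfield F) F (IsCMField.complexConj F) 2 (finProdFinEquiv : Fin 2 × Fin 1 ≃ Fin (2 * 1))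
        (Matrix.diagonal dJ) (complexConj_imagUnit F) (imagUnit_ne_zero F) (imagUnit_mul_self F) (realDiagonal_isSymm F dJ hdJ)
        (isUnit_det_realDiagonal F dJ hdJ hdJ0) (realDiagonal_map F dJ hdJ).symm
        (hsChiGS F finProdFinEquiv dJ hdJ hdJ0 χₕ hχu hχs) a χ).comp ι) :=
  isIrreducibleOrZero_rhoVAtLine_chiSplittingLine_comp_of_surjective F (finProdFinEquiv : Fin 2 × Fin 1 ≃ Fin (2 * 1)) le_rfl
    dJ hdJ hdJ0 χₕ hχu hχs a χ ι hι

/-- **The REGISTERED d6 carrier `ω⋆` on `U(J⋆)(𝔸_{F⁺,f})` is IRREDUCIBLE OR ZERO**: for a hermitian `J⋆`, a scalar `t ≠ 0` and a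
rational frame `g⋆` with `ᵗ(c g⋆) (t • J⋆) g⋆ = diag dJ`, the carrier `ω(μ, ε, χ)` at the line `⟨a⟩` read through
`(finAdelicCongr F⁺ F c g⋆ ht hg)⁻¹` (an isomorphism `U(J⋆)(𝔸_f) ≃ U(diag dJ)(𝔸_f)`) has no subrepresentation other than `0` and
everything — the text input (i) of the d6 line's S2′ node SHOULD read (Mathlib's `IsIrreducible` is false here whenever `ω⋆ = 0`,
which [Liu2021, Lem. D.1 (1)] allows at rank 2). [cite: Liu2021, Def. 4.11 (FJcycle.tex l. 2092–2096), App. D Lemma D.1 (1) (l. 5226–5229), Thm. D.6 (1) (l. 5436–5443)]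
[cite: GelbartRogawski1991, §3.1 Prop. 3.1.1 p. 455 L1–3] -/
theorem isIrreducibleOrZero_omegaStarGS {Jstar : Matrix (Fin 2) (Fin 2) F} {t : F} (ht : t ≠ 0) (gstar : GL (Fin 2) F)
    (hg : formCongr ((IsCMField.complexConj F : F ≃ₐ[↥(maximalRealSubfield F)] F) : F →+* F) gstar (t • Jstar) =
      Matrix.diagonal dJ) :
    IsIrreducibleOrZero
      ((rhoVAtLine ↥(maximalRealSubfield F) F (IsCMField.complexConj F) 2 (finProdFinEquiv : Fin 2 × Fin 1 ≃ Fin (2 * 1))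
        (Matrix.diagonal dJ) (complexConj_imagUnit F) (imagUnit_ne_zero F) (imagUnit_mul_self F) (realDiagonal_isSymm F dJ hdJ)
        (isUnit_det_realDiagonal F dJ hdJ hdJ0) (realDiagonal_map F dJ hdJ).symm
        (hsChiGS F finProdFinEquiv dJ hdJ hdJ0 χₕ hχu hχs) a χ).comp
        (finAdelicCongr ↥(maximalRealSubfield F) F (IsCMField.complexConj F) gstar ht hg).symm.toMonoidHom) :=
  isIrreducibleOrZero_rhoVAtLine_chiGS_comp F dJ hdJ hdJ0 χₕ hχu hχs a χ _
    (finAdelicCongr ↥(maximalRealSubfield F) F (IsCMField.complexConj F) gstar ht hg).symm.surjective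

/-- **the same as the CASE SPLIT the S2′ assembler consumes**: the registered carrier `ω⋆` is ZERO (its space `ω(μ, ε, χ)|_{⟨a⟩}` is a
subsingleton) OR Mathlib-irreducible (`isIrreducibleOrZero_iff_subsingleton_or_isIrreducible`).
[cite: Liu2021, Def. 4.11 (FJcycle.tex l. 2092–2096), App. D Lemma D.1 (1) (l. 5226–5229)] [cite: GelbartRogawski1991, §3.1 Prop. 3.1.1 p. 455 L1–3] -/
theorem subsingleton_or_isIrreducible_omegaStarGS {Jstar : Matrix (Fin 2) (Fin 2) F} {t : F} (ht : t ≠ 0) (gstar : GL (Fin 2) F)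
    (hg : formCongr ((IsCMField.complexConj F : F ≃ₐ[↥(maximalRealSubfield F)] F) : F →+* F) gstar (t • Jstar) =
      Matrix.diagonal dJ) :
    Subsingleton (omegaAtLine ↥(maximalRealSubfield F) F (IsCMField.complexConj F) 2 (finProdFinEquiv : Fin 2 × Fin 1 ≃ Fin (2 * 1))
        (Matrix.diagonal dJ) (complexConj_imagUnit F) (imagUnit_ne_zero F) (imagUnit_mul_self F) (realDiagonal_isSymm F dJ hdJ)
        (isUnit_det_realDiagonal F dJ hdJ hdJ0) (realDiagonal_map F dJ hdJ).symm
        (hsChiGS F finProdFinEquiv dJ hdJ hdJ0 χₕ hχu hχs) a χ) ∨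
      Representation.IsIrreducible
        ((rhoVAtLine ↥(maximalRealSubfield F) F (IsCMField.complexConj F) 2 (finProdFinEquiv : Fin 2 × Fin 1 ≃ Fin (2 * 1))
          (Matrix.diagonal dJ) (complexConj_imagUnit F) (imagUnit_ne_zero F) (imagUnit_mul_self F) (realDiagonal_isSymm F dJ hdJ)
          (isUnit_det_realDiagonal F dJ hdJ hdJ0) (realDiagonal_map F dJ hdJ).symm
          (hsChiGS F finProdFinEquiv dJ hdJ hdJ0 χₕ hχu hχs) a χ).comp
          (finAdelicCongr ↥(maximalRealSubfield F) F (IsCMField.complexConj F) gstar ht hg).symm.toMonoidHom) :=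
  (isIrreducibleOrZero_iff_subsingleton_or_isIrreducible _).1
    (isIrreducibleOrZero_omegaStarGS F dJ hdJ hdJ0 χₕ hχu hχs a χ ht gstar hg)

end Summit.HodgeConjecture.CorCM.Lines.A3Liu418

end
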